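import Summits.BirchSwinnertonDyer.BirchSwinnertonDyer.Theorems.KimAtThreeKolyvaginCertificateDictionary
import Summits.BirchSwinnertonDyer.Rank1Residual.Additive.N11KimAtThreeDeepCertPUB
import Literature.NumberTheory.EllipticCurves.TamagawaFiniteIndexProofs
import HarnessLib

/-!
# Route `KimAtThreeKolyvagin` (rung W2): crux `DeepLowerAtThree` from CERTIFICATE statements

Sequel of `KimAtThreeKolyvaginCertificateDictionary` (the `∂`-functional ⟺ certificate dictionary).
Crux `DeepLowerAtThree` (item 19075: `∂⁽⁰⁾(δ̃) ≤ ord₃ #Ш(E/ℚ)(3) + ∂^{(∞)}_{deep}(δ̃)` on every tower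
row of analytic rank `0`) is the `∂`-functional form of the cell's per-pair CERTIFICATE lane ("one
deep Kurihara number `δ̃_n ≢ 0 (mod 3^j)` bounds `ord₃(L(E,1)/Ω)` by `ord₃ #Ш + (j − 1)`", Cor C-t of
the cell memo `kim3/KIM3-PROOF.md` §16, typed as the `@[conjecture]` NAME `N11.KimAtThreeDeepCertPUB`,
p399215). Here:
* `kuriharaPartial_zero_le_natCast_of_padicValRat_le` — the reverse bridge BSD currency ⇒ `∂`-currency
  (`L(E,1)/Ω(W) = q`, `ord_p q ≤ m` ⇒ `∂⁽⁰⁾(δ̃) ≤ m`; odd `p`, `E[p]` irreducible, period transfer;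
  companion of `natCast_le_kuriharaPartial_zero_of_le_padicValRat` of `KimAtThreeKolyvaginDeepUpperRung`);
* **`deepLowerAtThree_of_uniformCertificateBound`** — the UNIFORM certificate statement in the
  `f`-currency (spelled inline, NOT a tree fact: on every row a depth threshold `K` — in print
  `K = 2 + t` — such that a certificate of depth `j + 1` at a cyclic level of depth `k ≥ K + j` forces
  `∂⁽⁰⁾ ≤ ord₃ #Ш(3) + j`) IMPLIES `DeepLowerAtThree` outright; conversely
  `certificateBound_of_deepLowerAtThree` extracts the NON-uniform bound (`∃` threshold per `(i, j)`)
  from the crux — the crux is exactly the non-uniform shadow of the certificate lane;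
* **`deepLower_datum_of_kimAtThreeDeepCertPUB`** / **`deepLower_optimal_of_kimAtThreeDeepCertPUB`** —
  GRANTED the landed name `N11.KimAtThreeDeepCertPUB` (carried as a hypothesis BY NAME), the
  conclusion of `DeepLowerAtThree` holds for the newform `D.f` of every parametrisation datum of a
  tower row with the `3`-adic period transfer, which `X4.periodTransfer_of_optimal` discharges for
  OPTIMAL data with `3 ∤ c_D`: the rigidity crux restricted to parametrised rows follows from the
  per-pair certificate NAME (the local-torsion exponent `t` of the name is fed with the trivial bound
  `#E(ℚ₃)[9] ≤ 3^{#E(ℚ₃)[9]}` — no arithmetic input).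
Nothing here is asserted; the crux and the name stay open.
[cite: Kim2025RefinedTNC, Thm 1.1] [cite: Kim2022StructureSelmer, Thm. 1.9 (6), §1.4.3 and §1.5.1 (PDF p. 7)]
[cite: MazurRubin2004, Thm. 5.2.12, Cor. 5.2.13]
-/

set_option autoImplicit false
-- the Theorems namespace of a single-conjunct summit repeats the summit name by design (D-0017)
set_option linter.dupNamespace false

noncomputable section

open scoped MatrixGroups ModularForm Classical

open CongruenceSubgroup WeierstrassCurve Literature.NumberTheory.EllipticCurves
  Literature.NumberTheory.EllipticCurves.ModularForms

namespace Summit.BirchSwinnertonDyer.BirchSwinnertonDyer.Theorems.KimAtThreeKolyvaginDeepLowerOfCertificate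

open Summit.BirchSwinnertonDyer.Rank1Residual.Additive
open Summit.BirchSwinnertonDyer.BirchSwinnertonDyer.Theses.KimAtThreeKolyvagin
open Summit.BirchSwinnertonDyer.BirchSwinnertonDyer.Theorems.KimAtThreeKolyvaginDeepUpperRung
open Summit.BirchSwinnertonDyer.BirchSwinnertonDyer.Theorems.KimAtThreeKolyvaginUnitLevelOneRungs
open Summit.BirchSwinnertonDyer.BirchSwinnertonDyer.Theorems.KimAtThreeKolyvaginCertificateDictionary

/-! ### The reverse bridge: BSD currency ⇒ `∂`-currency, `≤` direction (general odd `p`) -/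

section Bridge

variable (W : WeierstrassCurve ℚ) [W.IsElliptic] [W.IsGloballyMinimal] (p : ℕ) [Fact p.Prime]
  {N : ℕ} [NeZero N] (f : CuspForm (Gamma0 N) 2)

/-- **BSD currency ⇒ `∂`-currency (upper direction).** For odd `p`, `E[p]` irreducible, `f` the newform
of `W` with `[0]⁺_f ≠ 0` and the period transfer `Ω(W) = u · Ω⁺_f`, `|u|_p = 1`: if `L(E,1)/Ω(W) = q`
and `ord_p q ≤ m` then `∂⁽⁰⁾(δ̃) ≤ m` (`q = [0]⁺_f / u`, `ord_p q = ord_p [0]⁺_f = ∂⁽⁰⁾(δ̃)`). Companion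
of `natCast_le_kuriharaPartial_zero_of_le_padicValRat` (the `≥` direction).
[cite: Kim2022StructureSelmer, §1.4.3 and §1.5.1 (PDF p. 7)] [cite: MazurTateTeitelbaum1986Invent, §I.8 (8.6)] -/
theorem kuriharaPartial_zero_le_natCast_of_padicValRat_le (hp2 : p ≠ 2)
    (hirr : W.HasIrreducibleModPGaloisRep p) (hf : IsNewformOf W f) (h0 : ratPlusSymbol f 0 ≠ 0)
    (hper : ∃ u : ℚ, ‖(u : ℚ_[p])‖ = 1 ∧ W.realPeriodRat = u * plusPeriod f)
    {q : ℚ} (hq : W.entireLFunction 1 / (W.realPeriodRat : ℂ) = (q : ℂ)) {m : ℕ}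
    (hm : padicValRat p q ≤ (m : ℤ)) : kuriharaPartial W p f 0 ≤ (m : ℕ∞) := by
  have hint0 : ¬ p ∣ (ratPlusSymbol f 0).den :=
    not_dvd_den_of_norm_ratCast_le_one (norm_ratPlusSymbol_le_one_of_irreducible hp2 hf hirr 0)
  have hΩf : 0 < plusPeriod f := IsNewform0.plusPeriod_pos_holds hf.1 hf.coeffField_eq_bot
  obtain ⟨u, hu, hΩ⟩ := hper
  have hu0 : u ≠ 0 := by
    rintro rfl
    rw [Rat.cast_zero, norm_zero] at hu
    exact zero_ne_one hu
  -- `q = [0]⁺_f / u`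
  have hq' : q = ratPlusSymbol f 0 / u := by
    have hu' : (u : ℂ) ≠ 0 := by exact_mod_cast hu0
    have hΩf' : ((plusPeriod f : ℝ) : ℂ) ≠ 0 := by exact_mod_cast hΩf.ne'
    have h1 : (q : ℂ) = ((ratPlusSymbol f 0 / u : ℚ) : ℂ) := by
      rw [← hq, hf.entireLFunction_one_eq, hΩ]
      push_cast
      field_simp
    exact_mod_cast h1
  -- `ord_p u = 0`
  have hvu : padicValRat p u = 0 := by
    have hu0' : (u : ℚ_[p]) ≠ 0 := by exact_mod_cast hu0
    have h1 := hu
    rw [Padic.norm_eq_zpow_neg_valuation hu0', Padic.valuation_ratCast] at h1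
    have hp1 : (1 : ℝ) < (p : ℝ) := by exact_mod_cast (Fact.out : p.Prime).one_lt
    have h2 := (zpow_eq_one_iff_right₀ (zero_le_one.trans hp1.le) hp1.ne').mp h1
    linarith
  have hval : padicValRat p q = padicValRat p (ratPlusSymbol f 0) := by
    rw [hq', padicValRat.div h0 hu0, hvu, sub_zero]
  rw [hval] at hm
  rw [kuriharaPartial_zero, kuriharaDivIndex_one_eq W p f hint0 h0]
  have hnat : (padicValRat p (ratPlusSymbol f 0)).toNat ≤ m := by omega
  exact_mod_cast hnat

end Bridge

/-! ### `DeepLowerAtThree` from certificate statements -/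

/-- **The UNIFORM certificate bound implies crux `DeepLowerAtThree`.** Hypothesis `H` (Cor C-t of the
cell memo `kim3/KIM3-PROOF.md` §16 in the `f`-currency, spelled inline — NOT a tree fact): on every row
of the crux there is a depth threshold `K` (in print `K = 2 + t`, `3^t = #E(ℚ₃)[3^∞]`) such that a
certificate of depth `j + 1` (`δ̃_n ∉ 3^{j+1}ℤ₃/I_n`) at a cyclic level `n ∈ 𝒩_k(E,3)` with
`k ≥ K + j` forces `∂⁽⁰⁾(δ̃) ≤ ord₃ #Ш(E/ℚ)(3) + j`. Then `DeepLowerAtThree`: by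
`deepLower_conclusion_iff_eventuallyDivisible`, beyond depth `K + j` no certificate of depth `j + 1`
with `ord₃ #Ш(3) + j < ∂⁽⁰⁾` can exist. [cite: Kim2025RefinedTNC, Thm 1.1] [cite: MazurRubin2004, Thm. 5.2.12, Cor. 5.2.13]
[cite: Kim2022StructureSelmer, Thm. 1.9 (6)] -/
theorem deepLowerAtThree_of_uniformCertificateBound
    (H : ∀ (W : WeierstrassCurve ℚ) [W.IsElliptic] [W.IsGloballyMinimal],
      (∀ n : ℕ, W.HasSurjectiveModNGaloisRep (3 ^ n : ℕ)) → Finite W.sha →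
      ∀ {N : ℕ} [NeZero N] (f : CuspForm (Gamma0 N) 2), IsNewformOf W f →
      (∀ r : ℚ, ratPlusSymbol f r ≠ 0 → 0 ≤ padicValRat 3 (ratPlusSymbol f r)) →
      kuriharaVanishingOrder W 3 f = 0 →
      ∃ K : ℕ, ∀ j k n : ℕ, K + j ≤ k → IsCyclicKolyvaginLevel W 3 n →
        Kato.IsKolyvaginProduct W 3 k n → ¬ KuriharaDivisibleAt W 3 f n (j + 1) →
          kuriharaPartial W 3 f 0 ≤
            ((padicValNat 3 (Nat.card (AddCommGroup.primaryComponent W.sha 3)) + j : ℕ) : ℕ∞)) :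
    DeepLowerAtThree := by
  intro W _ _ htower hfin N _ f hf hint hord
  obtain ⟨K, hK⟩ := H W htower hfin f hf hint hord
  set s := padicValNat 3 (Nat.card (AddCommGroup.primaryComponent W.sha 3)) with hs
  -- `∂⁽⁰⁾(δ̃) = a` is finite in analytic rank `0`
  have hfin0 : kuriharaPartial W 3 f 0 < ⊤ := by
    rw [kuriharaPartial_zero]
    exact kuriharaDivIndex_one_lt_top_of_kuriharaVanishingOrder_eq_zero W 3 f hord
  obtain ⟨a, ha⟩ : ∃ a : ℕ, kuriharaPartial W 3 f 0 = a :=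
    (ENat.ne_top_iff_exists.mp hfin0.ne).imp fun a h => h.symm
  refine (deepLower_conclusion_iff_eventuallyDivisible W 3 f ha s).mpr ⟨?_, fun i j hj => ?_⟩
  · exact lt_of_le_of_lt (kuriharaPartialDeepInfty_le_kuriharaPartial_zero W 3 f) hfin0
  · refine ⟨K + j, fun n hn hkn _ => ?_⟩
    by_contra hcert
    have h' := hK j (K + j) n le_rfl hn hkn hcert
    rw [ha] at h'
    have h'' : a ≤ s + j := by exact_mod_cast h'
    omega

/-- **Conversely, crux `DeepLowerAtThree` yields the NON-uniform certificate bound**: on every row of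
the crux and for every `i`, `j`, there is a depth `k₀` beyond which a certificate of depth `j + 1` at a
cyclic level with `ν(n) = i` forces `∂⁽⁰⁾(δ̃) ≤ ord₃ #Ш(E/ℚ)(3) + j`.
[cite: Kim2025RefinedTNC, Thm 1.1] [cite: MazurRubin2004, Thm. 5.2.12] -/
theorem certificateBound_of_deepLowerAtThree (h : DeepLowerAtThree)
    (W : WeierstrassCurve ℚ) [W.IsElliptic] [W.IsGloballyMinimal]
    (htower : ∀ n : ℕ, W.HasSurjectiveModNGaloisRep (3 ^ n : ℕ)) (hfin : Finite W.sha)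
    {N : ℕ} [NeZero N] (f : CuspForm (Gamma0 N) 2) (hf : IsNewformOf W f)
    (hint : ∀ r : ℚ, ratPlusSymbol f r ≠ 0 → 0 ≤ padicValRat 3 (ratPlusSymbol f r))
    (hord : kuriharaVanishingOrder W 3 f = 0) (i j : ℕ) :
    ∃ k₀ : ℕ, ∀ k n : ℕ, k₀ ≤ k → IsCyclicKolyvaginLevel W 3 n → Kato.IsKolyvaginProduct W 3 k n →
      n.primeFactors.card = i → ¬ KuriharaDivisibleAt W 3 f n (j + 1) →
        kuriharaPartial W 3 f 0 ≤
          ((padicValNat 3 (Nat.card (AddCommGroup.primaryComponent W.sha 3)) + j : ℕ) : ℕ∞) := by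
  set s := padicValNat 3 (Nat.card (AddCommGroup.primaryComponent W.sha 3)) with hs
  have hfin0 : kuriharaPartial W 3 f 0 < ⊤ := by
    rw [kuriharaPartial_zero]
    exact kuriharaDivIndex_one_lt_top_of_kuriharaVanishingOrder_eq_zero W 3 f hord
  obtain ⟨a, ha⟩ : ∃ a : ℕ, kuriharaPartial W 3 f 0 = a :=
    (ENat.ne_top_iff_exists.mp hfin0.ne).imp fun a h => h.symm
  by_cases hj : s + j < a
  · obtain ⟨-, hdiv⟩ := (deepLower_conclusion_iff_eventuallyDivisible W 3 f ha s).mp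
      (h W htower hfin f hf hint hord)
    obtain ⟨k₀, hk₀⟩ := hdiv i j hj
    refine ⟨k₀, fun k n hk hn hkn hi hcert => ?_⟩
    exact absurd (hk₀ n hn (hkn.mono hk) hi) hcert
  · refine ⟨0, fun k n _ _ _ _ _ => ?_⟩
    rw [ha]
    exact_mod_cast (not_lt.mp hj)

/-! ### `DeepLowerAtThree` on parametrised rows from the cell's Cor C-t NAME -/

/-- **GRANTED `N11.KimAtThreeDeepCertPUB` (the cell's Cor C-t as a `@[conjecture]` NAME, p399215), the
conclusion of crux `DeepLowerAtThree` holds for the newform `D.f` of every parametrisation datum `D`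
of a tower row with `Ш(E/ℚ)` finite, `ord(δ̃) = 0` and the `3`-adic period transfer
`Ω(W) = u · Ω⁺_{D.f}`, `|u|₃ = 1`.** Proof: `deepLower_conclusion_iff_eventuallyDivisible` (⇐) with the
depth threshold `k = (j + 1) + 1 + t`, `t := #E(ℚ₃)[9]` (so `#E(ℚ₃)[9] ≤ 3^t` trivially): a certificate
of depth `j + 1` at such a level is an explicit `kuriharaNumber D.f (3^{k'}) n ψ ≠ 0` with
`1 ≤ k' ≤ j + 1` (`exists_kuriharaNumber_ne_zero_of_not_kuriharaDivisibleAt`), the name turns it into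
`ord₃(L(E,1)/Ω(W)) ≤ ord₃ #Ш(3) + (k' − 1)`, and the reverse bridge
`kuriharaPartial_zero_le_natCast_of_padicValRat_le` into `∂⁽⁰⁾(δ̃) ≤ ord₃ #Ш(3) + j`.
[cite: Kim2025RefinedTNC, Thm 1.1] [cite: Kim2022StructureSelmer, Thm. 1.9 (6), §1.5.1]
[cite: MazurRubin2004, Thm. 5.2.12] -/
theorem deepLower_datum_of_kimAtThreeDeepCertPUB (hK : N11.KimAtThreeDeepCertPUB)
    (W : WeierstrassCurve ℚ) [W.IsElliptic] [W.IsGloballyMinimal]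
    (htower : ∀ n : ℕ, W.HasSurjectiveModNGaloisRep (3 ^ n : ℕ)) (hfin : Finite W.sha)
    {N : ℕ} [NeZero N] (D : ModularParametrizationData W N)
    (hper : ∃ u : ℚ, ‖(u : ℚ_[3])‖ = 1 ∧ W.realPeriodRat = u * plusPeriod D.f)
    (hord : kuriharaVanishingOrder W 3 D.f = 0) :
    ∃ d : ℕ, kuriharaPartialDeepInfty W 3 D.f = d ∧
      kuriharaPartial W 3 D.f 0 ≤
        ((padicValNat 3 (Nat.card (AddCommGroup.primaryComponent W.sha 3)) + d : ℕ) : ℕ∞) := by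
  haveI : Fact (Nat.Prime 3) := ⟨Nat.prime_three⟩
  set s := padicValNat 3 (Nat.card (AddCommGroup.primaryComponent W.sha 3)) with hs
  have hirr : W.HasIrreducibleModPGaloisRep 3 :=
    hasIrreducibleModPGaloisRep_of_hasSurjectiveModNGaloisRep W 3 (by simpa using htower 1)
  have h0 : ratPlusSymbol D.f 0 ≠ 0 :=
    ratPlusSymbol_zero_ne_zero_of_kuriharaVanishingOrder_eq_zero W 3 D.f hord
  have hL : W.entireLFunction 1 ≠ 0 :=
    D.isNewformOf.entireLFunction_one_ne_zero_of_ratPlusSymbol_zero_ne_zero h0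
  have hfin0 : kuriharaPartial W 3 D.f 0 < ⊤ := by
    rw [kuriharaPartial_zero]
    exact kuriharaDivIndex_one_lt_top_of_kuriharaVanishingOrder_eq_zero W 3 D.f hord
  obtain ⟨a, ha⟩ : ∃ a : ℕ, kuriharaPartial W 3 D.f 0 = a :=
    (ENat.ne_top_iff_exists.mp hfin0.ne).imp fun a h => h.symm
  -- the local `3`-torsion bound: `t := #E(ℚ₃)[9]` itself
  set t := Nat.card {Q : (W.baseChange ℚ_[3]).toAffine.Point // (9 : ℕ) • Q = 0} with ht
  have ht' : Nat.card {Q : (W.baseChange ℚ_[3]).toAffine.Point // (9 : ℕ) • Q = 0} ≤ 3 ^ t :=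
    (Nat.lt_pow_self (by norm_num : 1 < 3)).le
  refine (deepLower_conclusion_iff_eventuallyDivisible W 3 D.f ha s).mpr ⟨?_, fun i j hj => ?_⟩
  · exact lt_of_le_of_lt (kuriharaPartialDeepInfty_le_kuriharaPartial_zero W 3 D.f) hfin0
  · refine ⟨j + 1 + 1 + t, fun n hn hkn _ => ?_⟩
    by_contra hcert
    obtain ⟨k', hk'1, hk'j, hk', ψ, hψ, hne⟩ :=
      exists_kuriharaNumber_ne_zero_of_not_kuriharaDivisibleAt W 3 D.f hcert
    haveI : NeZero n := ⟨hk'.ne_zero⟩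
    obtain ⟨q, hq, hle⟩ := hK W htower hL hfin D hper t k' (j + 1 + 1 + t) n ht' hk'1 (by omega)
      hkn (fun ℓ _ hℓ => hn.2 ℓ hℓ) ψ hψ hne
    have hle' : padicValRat 3 q ≤ ((s + j : ℕ) : ℤ) := by
      have : ((k' - 1 : ℕ) : ℤ) ≤ (j : ℤ) := by exact_mod_cast (show k' - 1 ≤ j by omega)
      push_cast at hle ⊢
      linarith
    have h' := kuriharaPartial_zero_le_natCast_of_padicValRat_le W 3 D.f (by norm_num) hirr
      D.isNewformOf h0 hper hq hle'
    rw [ha] at h'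
    have h'' : a ≤ s + j := by exact_mod_cast h'
    omega

/-- **The same with the period transfer DISCHARGED by optimality**: for an OPTIMAL parametrisation
datum `D` (every lattice point is `c_D` times a period of `D.f`) with `3 ∤ c_D`,
`X4.periodTransfer_of_optimal` supplies `Ω(W) = |c_D| · Ω⁺_{D.f}`; so GRANTED the Cor C-t name, crux
`DeepLowerAtThree` holds on every optimal tower row with `3 ∤ c_D` (for its own newform).
[cite: Kim2025RefinedTNC, Thm 1.1] [cite: CremonaAlgorithms1997, §2.8 (p. 26)] -/
theorem deepLower_optimal_of_kimAtThreeDeepCertPUB (hK : N11.KimAtThreeDeepCertPUB)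
    (W : WeierstrassCurve ℚ) [W.IsElliptic] [W.IsGloballyMinimal]
    (htower : ∀ n : ℕ, W.HasSurjectiveModNGaloisRep (3 ^ n : ℕ)) (hfin : Finite W.sha)
    {N : ℕ} [NeZero N] (D : ModularParametrizationData W N)
    (hopt : ∀ z ∈ D.L.lattice, ∃ w ∈ periodLattice D.f, z = D.c * w)
    (hc : ¬ (3 : ℤ) ∣ D.maninConstant)
    (hord : kuriharaVanishingOrder W 3 D.f = 0) :
    ∃ d : ℕ, kuriharaPartialDeepInfty W 3 D.f = d ∧
      kuriharaPartial W 3 D.f 0 ≤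
        ((padicValNat 3 (Nat.card (AddCommGroup.primaryComponent W.sha 3)) + d : ℕ) : ℕ∞) := by
  haveI : Fact (Nat.Prime 3) := ⟨Nat.prime_three⟩
  exact deepLower_datum_of_kimAtThreeDeepCertPUB hK W htower hfin D
    (Summit.BirchSwinnertonDyer.Rank1Residual.X4.periodTransfer_of_optimal 3 D hopt hc) hord

/-! ### The other two cruxes at the item level (kernel certificates: crux ⟺ certificate shape) -/

/-- **Crux `DeepUpperAtThree` ⟹ CERTIFICATE SUPPLY on every row of the crux**: with
`s = ord₃ #Ш(E/ℚ)(3)` and `∂⁽⁰⁾(δ̃) = a`, `s ≤ a` and for some `i` every depth `k > a − s` has a cyclic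
`n ∈ 𝒩_k(E,3)` with `ν(n) = i` and `δ̃_n ∉ 3^{a−s+1}ℤ₃/I_n` (item 19076 read through
`deepUpper_conclusion_iff_certificateSupply`). [cite: Kim2025RefinedTNC, Thm 1.1] [cite: MazurRubin2004, Thm. 5.2.12 (i)] -/
theorem certificateSupply_of_deepUpperAtThree (h : DeepUpperAtThree)
    (W : WeierstrassCurve ℚ) [W.IsElliptic] [W.IsGloballyMinimal]
    (htower : ∀ n : ℕ, W.HasSurjectiveModNGaloisRep (3 ^ n : ℕ)) (hfin : Finite W.sha)
    {N : ℕ} [NeZero N] (f : CuspForm (Gamma0 N) 2) (hf : IsNewformOf W f)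
    (hint : ∀ r : ℚ, ratPlusSymbol f r ≠ 0 → 0 ≤ padicValRat 3 (ratPlusSymbol f r))
    (hord : kuriharaVanishingOrder W 3 f = 0) {a : ℕ} (ha : kuriharaPartial W 3 f 0 = a) :
    padicValNat 3 (Nat.card (AddCommGroup.primaryComponent W.sha 3)) ≤ a ∧
      ∃ i, ∀ k, a - padicValNat 3 (Nat.card (AddCommGroup.primaryComponent W.sha 3)) < k →
        ∃ n, IsCyclicKolyvaginLevel W 3 n ∧ Kato.IsKolyvaginProduct W 3 k n ∧
          n.primeFactors.card = i ∧
            ¬ KuriharaDivisibleAt W 3 f n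
              (a - padicValNat 3 (Nat.card (AddCommGroup.primaryComponent W.sha 3)) + 1) :=
  (deepUpper_conclusion_iff_certificateSupply W 3 f ha _).mp (h W htower hfin f hf hint hord)

/-- **CERTIFICATE SUPPLY on every row ⟹ crux `DeepUpperAtThree`** (the converse; the supply
statement is spelled inline as the hypothesis `H`, NOT a tree fact).
[cite: Kim2025RefinedTNC, Thm 1.1] [cite: MazurRubin2004, Thm. 5.2.12 (i)] -/
theorem deepUpperAtThree_of_certificateSupply
    (H : ∀ (W : WeierstrassCurve ℚ) [W.IsElliptic] [W.IsGloballyMinimal],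
      (∀ n : ℕ, W.HasSurjectiveModNGaloisRep (3 ^ n : ℕ)) → Finite W.sha →
      ∀ {N : ℕ} [NeZero N] (f : CuspForm (Gamma0 N) 2), IsNewformOf W f →
      (∀ r : ℚ, ratPlusSymbol f r ≠ 0 → 0 ≤ padicValRat 3 (ratPlusSymbol f r)) →
      kuriharaVanishingOrder W 3 f = 0 → ∀ a : ℕ, kuriharaPartial W 3 f 0 = a →
        padicValNat 3 (Nat.card (AddCommGroup.primaryComponent W.sha 3)) ≤ a ∧
        ∃ i, ∀ k, a - padicValNat 3 (Nat.card (AddCommGroup.primaryComponent W.sha 3)) < k →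
          ∃ n, IsCyclicKolyvaginLevel W 3 n ∧ Kato.IsKolyvaginProduct W 3 k n ∧
            n.primeFactors.card = i ∧
              ¬ KuriharaDivisibleAt W 3 f n
                (a - padicValNat 3 (Nat.card (AddCommGroup.primaryComponent W.sha 3)) + 1)) :
    DeepUpperAtThree := by
  intro W _ _ htower hfin N _ f hf hint hord
  have hfin0 : kuriharaPartial W 3 f 0 < ⊤ := by
    rw [kuriharaPartial_zero]
    exact kuriharaDivIndex_one_lt_top_of_kuriharaVanishingOrder_eq_zero W 3 f hord
  obtain ⟨a, ha⟩ : ∃ a : ℕ, kuriharaPartial W 3 f 0 = a :=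
    (ENat.ne_top_iff_exists.mp hfin0.ne).imp fun a h => h.symm
  exact (deepUpper_conclusion_iff_certificateSupply W 3 f ha _).mpr (H W htower hfin f hf hint hord a ha)

/-- **Crux `ShallowEqDeepAtTorsionFree` ⟹ NO SHALLOW CERTIFICATE below the deep limit** on every row
of the crux (item 19077 read through `shallowEqDeep_conclusion_iff_noShallowCertificate`): a
certificate of depth `j + 1` at ANY cyclic level forces `∂^{(∞)}_{deep}(δ̃) ≤ j`.
[cite: Kim2025RefinedTNC, Thm 1.1] [cite: Kim2022StructureSelmer, §1.5.1 (PDF p. 7)] -/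
theorem noShallowCertificate_of_shallowEqDeepAtTorsionFree (h : ShallowEqDeepAtTorsionFree)
    (W : WeierstrassCurve ℚ) [W.IsElliptic] [W.IsGloballyMinimal]
    (htower : ∀ n : ℕ, W.HasSurjectiveModNGaloisRep (3 ^ n : ℕ))
    (ht0 : Nat.card {Q : (W.baseChange ℚ_[3]).toAffine.Point // (3 : ℕ) • Q = 0} = 1)
    (hfin : Finite W.sha) {N : ℕ} [NeZero N] (f : CuspForm (Gamma0 N) 2) (hf : IsNewformOf W f)
    (hint : ∀ r : ℚ, ratPlusSymbol f r ≠ 0 → 0 ≤ padicValRat 3 (ratPlusSymbol f r))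
    (hord : kuriharaVanishingOrder W 3 f = 0) :
    ∀ n j : ℕ, IsCyclicKolyvaginLevel W 3 n → ¬ KuriharaDivisibleAt W 3 f n (j + 1) →
      kuriharaPartialDeepInfty W 3 f ≤ j :=
  (shallowEqDeep_conclusion_iff_noShallowCertificate W 3 f).mp (h W htower ht0 hfin f hf hint hord)

/-- **NO SHALLOW CERTIFICATE below the deep limit on every row ⟹ crux `ShallowEqDeepAtTorsionFree`**
(the converse; hypothesis spelled inline, NOT a tree fact).
[cite: Kim2025RefinedTNC, Thm 1.1] [cite: Kim2022StructureSelmer, §1.5.1 (PDF p. 7)] -/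
theorem shallowEqDeepAtTorsionFree_of_noShallowCertificate
    (H : ∀ (W : WeierstrassCurve ℚ) [W.IsElliptic] [W.IsGloballyMinimal],
      (∀ n : ℕ, W.HasSurjectiveModNGaloisRep (3 ^ n : ℕ)) →
      Nat.card {Q : (W.baseChange ℚ_[3]).toAffine.Point // (3 : ℕ) • Q = 0} = 1 → Finite W.sha →
      ∀ {N : ℕ} [NeZero N] (f : CuspForm (Gamma0 N) 2), IsNewformOf W f →
      (∀ r : ℚ, ratPlusSymbol f r ≠ 0 → 0 ≤ padicValRat 3 (ratPlusSymbol f r)) →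
      kuriharaVanishingOrder W 3 f = 0 →
      ∀ n j : ℕ, IsCyclicKolyvaginLevel W 3 n → ¬ KuriharaDivisibleAt W 3 f n (j + 1) →
        kuriharaPartialDeepInfty W 3 f ≤ j) :
    ShallowEqDeepAtTorsionFree := by
  intro W _ _ htower ht0 hfin N _ f hf hint hord
  exact (shallowEqDeep_conclusion_iff_noShallowCertificate W 3 f).mpr
    (H W htower ht0 hfin f hf hint hord)

/-! ### The cell's kill test T0-TAM in the kernel: what ONE shallow unit would refute -/

/-- **(`DeepLowerAtThree` ∧ `ShallowEqDeepAtTorsionFree`) + Kato's Tamagawa-EXACT reading ⟹ on Kato's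
stratum with `t = 0`, a UNIT Kurihara number at ANY cyclic level forces `3 ∤ ∏_ℓ c_ℓ`.** Chain:
`v₃(∏ c_ℓ) ≤ ∂^{(∞)}_{deep}(δ̃)` (crux 19075 with the named fact,
`tamagawa_le_kuriharaPartialDeepInfty_of_deepLowerAtThree_of_kato2004TamagawaExact`) `≤ ∂^{(∞)}(δ̃)`
(crux 19077, `t = 0`) `= 0` (the unit, `kuriharaPartialInfty_eq_zero_of_ne_zero`), and `∏ c_ℓ > 0`.
This is the logical basis of the cell's pre-registered kit test T0-TAM (HOME/kim3/p7test, 2026-08-26):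
ONE unit `δ̃_n` on a tower, `t = 0`, additive potentially good row with the period transfer (optimal,
`3 ∤ c₀`) and `3 ∣ ∏_ℓ c_ℓ` refutes `DeepLowerAtThree ∧ ShallowEqDeepAtTorsionFree` GIVEN ONLY the
published fact `hKato` (hypothesis by name). [cite: Kato2004Asterisque, Thm. 14.5 (3) (p. 236), Prop. 14.16 (2) (p. 244), §14.8 (p. 238)]
[cite: Kim2025RefinedTNC, Thm 1.1] [cite: Kim2022StructureSelmer, §1.5.1 (PDF p. 7), Conj. 1.10 (PDF p. 8)] -/
theorem not_three_dvd_tamagawaProduct_of_unit_of_deepLower_of_shallowEqDeep_of_kato2004TamagawaExact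
    (hL : DeepLowerAtThree) (hS : ShallowEqDeepAtTorsionFree)
    (hKato : Kato2004.rankZero_padicValNat_sha_add_padicValNat_tamagawa_le_of_additive_potGood_of_imageContainsSL2)
    (W : WeierstrassCurve ℚ) [W.IsElliptic] [W.IsGloballyMinimal]
    (htower : ∀ n : ℕ, W.HasSurjectiveModNGaloisRep (3 ^ n : ℕ))
    (ht0 : Nat.card {Q : (W.baseChange ℚ_[3]).toAffine.Point // (3 : ℕ) • Q = 0} = 1)
    (hfin : Finite W.sha) {N : ℕ} [NeZero N] (f : CuspForm (Gamma0 N) 2) (hf : IsNewformOf W f)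
    (hint : ∀ r : ℚ, ratPlusSymbol f r ≠ 0 → 0 ≤ padicValRat 3 (ratPlusSymbol f r))
    (hord : kuriharaVanishingOrder W 3 f = 0)
    (hgood : ¬ W.HasGoodReductionAtPrime 3) (hmult : ¬ W.HasMultiplicativeReductionAtPrime 3)
    (hpot : 0 ≤ padicValRat 3 W.j)
    (hper : ∃ u : ℚ, ‖(u : ℚ_[3])‖ = 1 ∧ W.realPeriodRat = u * plusPeriod f)
    {n : ℕ} [NeZero n] (hn : IsCyclicKolyvaginLevel W 3 n)
    (ψ : (ℓ : ℕ) → (ZMod ℓ)ˣ →* Multiplicative (ZMod (3 ^ 1)))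
    (hψ : ∀ ℓ ∈ n.primeFactors, Function.Surjective (ψ ℓ))
    (hunit : kuriharaNumber f (3 ^ 1) n ψ ≠ 0) : ¬ 3 ∣ W.tamagawaProduct := by
  haveI : Fact (Nat.Prime 3) := ⟨Nat.prime_three⟩
  intro hdvd
  have h1 := tamagawa_le_kuriharaPartialDeepInfty_of_deepLowerAtThree_of_kato2004TamagawaExact hL hKato
    W htower hfin f hf hint hord hgood hmult hpot hper
  have h2 : kuriharaPartialDeepInfty W 3 f ≤ kuriharaPartialInfty W 3 f :=
    hS W htower ht0 hfin f hf hint hord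
  have h3 : kuriharaPartialInfty W 3 f = 0 := kuriharaPartialInfty_eq_zero_of_ne_zero W 3 f hn ψ hψ hunit
  have h : ((padicValNat 3 W.tamagawaProduct : ℕ) : ℕ∞) ≤ 0 := (h1.trans h2).trans h3.le
  have h' : padicValNat 3 W.tamagawaProduct = 0 := by exact_mod_cast nonpos_iff_eq_zero.mp h
  have h1' : 1 ≤ padicValNat 3 W.tamagawaProduct :=
    one_le_padicValNat_of_dvd W.tamagawaProduct_pos'.ne' hdvd
  omega

end Summit.BirchSwinnertonDyer.BirchSwinnertonDyer.Theorems.KimAtThreeKolyvaginDeepLowerOfCertificate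

end
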